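import Summits.QuantumFields.YangMills.Theorems.BalabanUVNodesN16CentreConventionAllDepths
import HarnessLib

/-!
# YM-DAG node N16 (NE3), the located averaging pin (42) ↔ (0.4) — part 17: N16's END OBJECT IS SCHEME-INDEPENDENT — the minimal level-`k` action
# `A_k(V) = minAct` (the `act` of N16's reading carrier `minActReadings`) is THE SAME for every averaging scheme pointwise coarse-gauge equivalent to (43);
# instance: the centre-convention torus (42) `cstep` at every depth in the (8)-radius regime

Cell `pub-ymgap`, width seat `pub-ymgap-dag-n16-w3` (director-ym №197 ∕ HUMAN RULING D-0149), generation 7; part 17 of the W1b lineage (part 12 p612224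
`ExactGaugeDefect` ∕ `minimiser_transfer`; part 14 p616704 `SchemeGaugeEquiv`; part 16 `…N16CentreConventionAllDepths`: `SchemeGaugeEquiv (step42) (cstep)` at
every depth).  `--kind proof --supports stmt-QuantumFields-20544 --as helper` (K3⁷; count-neutral; 0 `def`).  `bears_on: R4∕N16`.

THE POINT.  Parts 12∕14∕16 transfer MINIMISERS and their gauge-invariant properties between gauge-equivalent schemes.  N16's END, however, is not a statement about
minimisers but about the minimal ACTIONS: the record reading carrier `MinimalActionRate.minActReadings 𝒞 L N dom loc` has `act k V = minAct d 𝒞 L N k V =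
sInf (levelAction d L N k '' admissible 𝒞 L k V)` ([Balaban1985Variational] (5)–(6): `A_k(V) = inf` of the level-`k` Wilson action over the (43)-admissible
configurations), and `NE3Shape`∕`ActionRate` read differences of these numbers.  This file shows the numbers themselves do not see the scheme:
 * §1 (any two schemes, part 14's `SchemeGaugeEquiv d s₁ s₂ L N k (𝒞 k)` on a gauge-invariant class; `schemeGaugeEquiv_trans`: with part 14's `.symm` an
   EQUIVALENCE RELATION on block-lift-covariant schemes, whose class invariants this file computes): every `s₂`-admissible configuration of datum `V` is carried
   by a unitary `(N·L^k)`-periodic gauge (the block lift of its own `κ_U`) to an `s₁`-admissible configuration of THE SAME datum (`exists_gaugeAct_mem_admissibleS`),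
   so — the level action being gauge invariant (`NE7EtaMinimiserGaugeCovariance.levelAction_gaugeAct`) — ★★ the ACTION VALUE SETS COINCIDE:
   `levelAction '' admissibleS s₂ 𝒞 k V = levelAction '' admissibleS s₁ 𝒞 k V` (`image_levelAction_admissibleS_eq`); hence their infima coincide and admissibility
   (non-emptiness of the constrained problem) transfers.  No minimiser is assumed to exist.
 * §2 (against (43), `s₁ = step42`, g0's dictionary `admissibleS_step42`): ★★ `sInf_levelAction_admissibleS_eq_minAct` — the `s`-constrained minimal action IS the
   tree's `minAct d 𝒞 L N k V` for every scheme `s` gauge-equivalent to (43) (also under part 12's criterion `ExactGaugeDefect`); an `s`-constrained minimiser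
   realises `minAct` (`minAct_eq_levelAction_of_isMinimiserS`).
 * §3 THE INSTANCE (part 16): on `sfClass d L T ε` in the (8)-radius regime (`0 ≤ ε`, `16C₀(d)ε ≤ 3`, `1024(d+1)(d+4)L²ε ≤ 1`), at EVERY depth `k` and EVERY
   datum `V`, the minimal level-`k` action over the configurations whose centre-convention torus average `cstep^k` is `V` EQUALS `minAct d (sfClass d L T ε) L T k V`
   (`sInf_levelAction_admissibleS_cstep_eq_minAct`); at N16's objects of record (`d = 4`, `P := F.P K`, `T = 2L^m`) the `act` of the reading carrier
   `minActReadings (sfClass 4 F.L (2L^m) ε) F.L (2L^m) dom loc` is, for every `ε ≤ ε_reg(L)`, every `k` and every `V`, LITERALLY the `cstep`-constrained minimal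
   action (`act_minActReadings_eq_sInf_cstep`) — so every `ActionRate`∕`NE3Shape` sentence about N16's carrier is simultaneously the sentence for the tree's NE7
   torus instance of (42) in Setup's centred convention; ★★ `minActReadings_eq_cstepReadings`: the record carrier EQUALS (as a `T4EtaRateMin.Readings` value)
   the displayed `cstep` carrier, whence `ne3Shape_cstepReadings_iff` ∕ `actionRate_cstepReadings_iff` by `rw`.
READING (honest).  Bookkeeping: the END numbers `A_k(V)` of N16 are invariants of the coarse-gauge-equivalence class of the averaging scheme; Setup's DIVERGENCE F3
and the guard are invisible to them.  Nothing here compares (42) with the averaging of record (0.4) (`step04`), whose equivalence to (43) is NOT established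
(`W3-PIN-ANATOMY-v4.md` §4 (i), (iii)).

HONEST FRAMING.  [folklore] bookkeeping BY NAME over parts 14∕16, g0's `N16AveragingPin` (`admissibleS`, `IsMinimiserS`, `admissibleS_step42`), pub-balaban's
`MinimalActionSandwich.minAct` ∕ `MinimalActionRate.minActReadings` ∕ `NE7EtaMinimiserGaugeCovariance.levelAction_gaugeAct` ∕ `NE3ResidualSliceRep.mem_sfClass_gaugeAct`;
0 `def`, 0 `sorry`, no `instance`, no `notation`; no minimiser constructed or assumed; nothing of [Balaban1985Variational] ∕ [Balaban1987RG1] asserted; K3⁷ stubs NOT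
touched; N16 ∕ NE3 NOT discharged; count-neutral (typed 28∕28 · discharged 5∕27 work-bound, A 5∕28 — unmoved).  One finite four-torus programme at fixed `ε` — the
Yang–Mills mass gap (Clay) is NOT proved by any of this; R4 closes the conditional finite-𝕋⁴ rung `BalabanLadder.UV` only; nothing continuum ∕ ℝ⁴ ∕ OS.
-/

set_option autoImplicit false

open scoped BigOperators Matrix Matrix.Norms.L2Operator
open NormedSpace

namespace Summit.QuantumFields.YangMills.BalabanUVNodes.N16SchemeMinActInvariance

open Literature.MathematicalPhysics.QuantumFieldTheory.Balaban1983to89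
open Literature.MathematicalPhysics.QuantumFieldTheory.Balaban1983to89.T4Continuum (T4Family)
open B7Prop1Explicit B7Prop2Explicit
open Summit.QuantumFields.BalabanUV.T4Continuum
open MinimalActionLevels (levelAction)
open MinimalActionSandwich (admissible minAct IsMinimiser)
open MinimalActionRate (sfClass minActReadings)
open NE3EnergyShapes (IsUnitarySite IsPeriodicSite)
open NE3ResidualSliceRep (mem_sfClass_gaugeAct)
open AveragingDeficitKDatum (gaugeAct_inv_gaugeAct)
open NE7EtaMinimiserGaugeCovariance (levelAction_gaugeAct)
open Node00 (MatA ne3NperOfRecord₁₁ ne3DomOfRecord₁₁)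
open Summit.QuantumFields.YangMills.BalabanUVNodes.N16AveragingPin
  (avgIterS step42 avgIterS_step42 admissibleS mem_admissibleS_iff admissibleS_step42 IsMinimiserS)
open Summit.QuantumFields.YangMills.BalabanUVNodes.N16AveragingTransferOfGaugeDefect
  (isUnitarySite_blockLift isPeriodicSite_blockLift ExactGaugeDefect)
open Summit.QuantumFields.YangMills.BalabanUVNodes.N16CentreConventionTransfer (SchemeGaugeEquiv ExactGaugeDefect.toSchemeGaugeEquiv gaugeAct_gaugeAct)
open Summit.QuantumFields.YangMills.BalabanUVNodes.N16CentreConventionAllDepths (schemeGaugeEquiv_step42_cstep regimeRadius_pos regime_of_le_regimeRadius)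
open Summit.QuantumFields.BalabanUV.T4Continuum.Spine.NE7.TorusB7 (Mat cstep)

noncomputable section

/-! ## §1 Gauge-equivalent schemes have the same admissible action values at every datum -/

section Schemes

variable {d : ℕ} {n : Type*} [Fintype n] [DecidableEq n]
variable {s s₁ s₂ : ℕ → (Site d → Fin d → (Matrix n n ℂ)ˣ) → (Site d → Fin d → (Matrix n n ℂ)ˣ)}
  {𝒞 : ℕ → Set (Site d → Fin d → (Matrix n n ℂ)ˣ)} {L N k : ℕ}

/-- **COARSE-GAUGE EQUIVALENCE OF SCHEMES IS TRANSITIVE** (with part 14's `SchemeGaugeEquiv.symm`: an equivalence relation on the block-lift-covariant schemes of a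
class and depth — the data-dependent gauges multiply, `gaugeAct_gaugeAct`); the numbers of §1–§2 below are invariants of the equivalence class. [folklore] -/
theorem schemeGaugeEquiv_trans {s₃ : ℕ → (Site d → Fin d → (Matrix n n ℂ)ˣ) → (Site d → Fin d → (Matrix n n ℂ)ˣ)}
    {C : Set (Site d → Fin d → (Matrix n n ℂ)ˣ)} (h₁₂ : SchemeGaugeEquiv d s₁ s₂ L N k C) (h₂₃ : SchemeGaugeEquiv d s₂ s₃ L N k C) :
    SchemeGaugeEquiv d s₁ s₃ L N k C where
  cov₁ := h₁₂.cov₁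
  cov₂ := h₂₃.cov₂
  defect U hU := by
    obtain ⟨κ, hκ, hκP, h⟩ := h₁₂.defect U hU
    obtain ⟨κ', hκ', hκ'P, h'⟩ := h₂₃.defect U hU
    refine ⟨fun z => κ' z * κ z, fun z => (unitaryUnits (Matrix n n ℂ)).mul_mem (hκ' z) (hκ z), fun z i => ?_, ?_⟩
    · show κ' (z + (N : ℤ) • e i) * κ (z + (N : ℤ) • e i) = κ' z * κ z
      rw [hκ'P z i, hκP z i]
    · rw [h', h, gaugeAct_gaugeAct]

/-- **EVERY `s₂`-ADMISSIBLE CONFIGURATION IS A GAUGE TRANSFORM OF AN `s₁`-ADMISSIBLE ONE WITH THE SAME DATUM**: under `SchemeGaugeEquiv d s₁ s₂ L N k (𝒞 k)` on a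
class invariant under unitary `(N·L^k)`-periodic gauges, for `U ∈ admissibleS s₂ 𝒞 k V` the block lift `u` of its own `κ_U` (unitary, `(N·L^k)`-periodic) has
`U^{u} ∈ admissibleS s₁ 𝒞 k V`: (cov₁) moves `s₁`'s average by `κ_U`, (defect) says that is `s₂`'s average `= V`. [folklore] -/
theorem exists_gaugeAct_mem_admissibleS (hL : 1 ≤ L)
    (hC : ∀ (u : Site d → (Matrix n n ℂ)ˣ) (U : Site d → Fin d → (Matrix n n ℂ)ˣ), IsUnitarySite u →
      IsPeriodicSite u ((N * L ^ k : ℕ) : ℤ) → U ∈ 𝒞 k → gaugeAct u U ∈ 𝒞 k)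
    (hE : SchemeGaugeEquiv d s₁ s₂ L N k (𝒞 k)) {V U : Site d → Fin d → (Matrix n n ℂ)ˣ} (hU : U ∈ admissibleS s₂ 𝒞 k V) :
    ∃ u : Site d → (Matrix n n ℂ)ˣ, IsUnitarySite u ∧ IsPeriodicSite u ((N * L ^ k : ℕ) : ℤ) ∧ gaugeAct u U ∈ admissibleS s₁ 𝒞 k V := by
  obtain ⟨hUC, hUV⟩ := hU
  obtain ⟨κ, hκ, hκP, hdef⟩ := hE.defect U hUC
  refine ⟨fun x : Site d => κ (fun i => x i / (L : ℤ) ^ k), isUnitarySite_blockLift hκ _, isPeriodicSite_blockLift L hL k hκP, ?_, ?_⟩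
  · exact hC _ _ (isUnitarySite_blockLift hκ _) (isPeriodicSite_blockLift L hL k hκP) hUC
  · rw [hE.cov₁ κ U hκ hκP hUC, ← hdef, hUV]

/-- **★★ THE ADMISSIBLE ACTION VALUE SETS OF TWO GAUGE-EQUIVALENT SCHEMES COINCIDE AT EVERY DATUM** (the level-`k` Wilson action is gauge invariant,
`levelAction_gaugeAct`; §1's transport in both directions, the converse through `hE.symm`): `A^{(k)}(admissibleS s₂ 𝒞 k V) = A^{(k)}(admissibleS s₁ 𝒞 k V)`.
No minimiser is assumed. [folklore] -/
theorem image_levelAction_admissibleS_eq (hL : 1 ≤ L)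
    (hC : ∀ (u : Site d → (Matrix n n ℂ)ˣ) (U : Site d → Fin d → (Matrix n n ℂ)ˣ), IsUnitarySite u →
      IsPeriodicSite u ((N * L ^ k : ℕ) : ℤ) → U ∈ 𝒞 k → gaugeAct u U ∈ 𝒞 k)
    (hE : SchemeGaugeEquiv d s₁ s₂ L N k (𝒞 k)) (V : Site d → Fin d → (Matrix n n ℂ)ˣ) :
    levelAction d L N k '' admissibleS s₂ 𝒞 k V = levelAction d L N k '' admissibleS s₁ 𝒞 k V := by
  ext a
  constructor
  · rintro ⟨U, hU, rfl⟩
    obtain ⟨u, -, -, hu⟩ := exists_gaugeAct_mem_admissibleS hL hC hE hU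
    exact ⟨_, hu, levelAction_gaugeAct L N k u U⟩
  · rintro ⟨U, hU, rfl⟩
    obtain ⟨u, -, -, hu⟩ := exists_gaugeAct_mem_admissibleS hL hC hE.symm hU
    exact ⟨_, hu, levelAction_gaugeAct L N k u U⟩

/-- Hence the constrained minimal actions (the infima of the level action over the admissible sets) coincide at every datum. [folklore] -/
theorem sInf_levelAction_admissibleS_eq (hL : 1 ≤ L)
    (hC : ∀ (u : Site d → (Matrix n n ℂ)ˣ) (U : Site d → Fin d → (Matrix n n ℂ)ˣ), IsUnitarySite u →
      IsPeriodicSite u ((N * L ^ k : ℕ) : ℤ) → U ∈ 𝒞 k → gaugeAct u U ∈ 𝒞 k)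
    (hE : SchemeGaugeEquiv d s₁ s₂ L N k (𝒞 k)) (V : Site d → Fin d → (Matrix n n ℂ)ˣ) :
    sInf (levelAction d L N k '' admissibleS s₂ 𝒞 k V) = sInf (levelAction d L N k '' admissibleS s₁ 𝒞 k V) := by
  rw [image_levelAction_admissibleS_eq hL hC hE V]

/-- And admissibility of the datum transfers: the `s₂`-constrained problem at `V` is non-empty iff the `s₁`-constrained one is. [folklore] -/
theorem nonempty_admissibleS_iff (hL : 1 ≤ L)
    (hC : ∀ (u : Site d → (Matrix n n ℂ)ˣ) (U : Site d → Fin d → (Matrix n n ℂ)ˣ), IsUnitarySite u →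
      IsPeriodicSite u ((N * L ^ k : ℕ) : ℤ) → U ∈ 𝒞 k → gaugeAct u U ∈ 𝒞 k)
    (hE : SchemeGaugeEquiv d s₁ s₂ L N k (𝒞 k)) (V : Site d → Fin d → (Matrix n n ℂ)ˣ) :
    (admissibleS s₂ 𝒞 k V).Nonempty ↔ (admissibleS s₁ 𝒞 k V).Nonempty := by
  constructor
  · rintro ⟨U, hU⟩
    obtain ⟨u, -, -, hu⟩ := exists_gaugeAct_mem_admissibleS hL hC hE hU
    exact ⟨_, hu⟩
  · rintro ⟨U, hU⟩
    obtain ⟨u, -, -, hu⟩ := exists_gaugeAct_mem_admissibleS hL hC hE.symm hU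
    exact ⟨_, hu⟩

/-! ## §2 Against (43): the `s`-constrained minimal action IS the tree's `minAct` -/

/-- **★★ THE `s`-CONSTRAINED MINIMAL ACTION IS `minAct`**: for every scheme `s` pointwise coarse-gauge equivalent to (43) (`SchemeGaugeEquiv d (step42) s`) on a
gauge-invariant class, `inf A^{(k)}(admissibleS s 𝒞 k V) = minAct d 𝒞 L N k V` (`MinimalActionSandwich.minAct` = [Balaban1985Variational] (5)–(6)'s `A_k(V)` for
the (43)-constraint; g0's dictionary `admissibleS_step42`). [folklore] -/
theorem sInf_levelAction_admissibleS_eq_minAct (hL : 1 ≤ L)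
    (hC : ∀ (u : Site d → (Matrix n n ℂ)ˣ) (U : Site d → Fin d → (Matrix n n ℂ)ˣ), IsUnitarySite u →
      IsPeriodicSite u ((N * L ^ k : ℕ) : ℤ) → U ∈ 𝒞 k → gaugeAct u U ∈ 𝒞 k)
    (hE : SchemeGaugeEquiv d (fun _ => step42 L) s L N k (𝒞 k)) (V : Site d → Fin d → (Matrix n n ℂ)ˣ) :
    sInf (levelAction d L N k '' admissibleS s 𝒞 k V) = minAct d 𝒞 L N k V := by
  rw [sInf_levelAction_admissibleS_eq hL hC hE V, admissibleS_step42]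
  rfl

/-- The image form: `A^{(k)}(admissibleS s 𝒞 k V) = A^{(k)}(admissible 𝒞 L k V)`. [folklore] -/
theorem image_levelAction_admissibleS_eq_admissible (hL : 1 ≤ L)
    (hC : ∀ (u : Site d → (Matrix n n ℂ)ˣ) (U : Site d → Fin d → (Matrix n n ℂ)ˣ), IsUnitarySite u →
      IsPeriodicSite u ((N * L ^ k : ℕ) : ℤ) → U ∈ 𝒞 k → gaugeAct u U ∈ 𝒞 k)
    (hE : SchemeGaugeEquiv d (fun _ => step42 L) s L N k (𝒞 k)) (V : Site d → Fin d → (Matrix n n ℂ)ˣ) :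
    levelAction d L N k '' admissibleS s 𝒞 k V = levelAction d L N k '' admissible 𝒞 L k V := by
  rw [image_levelAction_admissibleS_eq hL hC hE V, admissibleS_step42]

/-- The same under part 12's criterion `ExactGaugeDefect d s L N k (𝒞 k)` (the case `s₁ = step42` of `SchemeGaugeEquiv`, part 14). [folklore] -/
theorem sInf_levelAction_admissibleS_eq_minAct_of_exactGaugeDefect (hL : 1 ≤ L)
    (hC : ∀ (u : Site d → (Matrix n n ℂ)ˣ) (U : Site d → Fin d → (Matrix n n ℂ)ˣ), IsUnitarySite u →
      IsPeriodicSite u ((N * L ^ k : ℕ) : ℤ) → U ∈ 𝒞 k → gaugeAct u U ∈ 𝒞 k)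
    (hE : ExactGaugeDefect d s L N k (𝒞 k)) (V : Site d → Fin d → (Matrix n n ℂ)ˣ) :
    sInf (levelAction d L N k '' admissibleS s 𝒞 k V) = minAct d 𝒞 L N k V :=
  sInf_levelAction_admissibleS_eq_minAct hL hC (ExactGaugeDefect.toSchemeGaugeEquiv hL hE) V

/-- **AN `s`-CONSTRAINED MINIMISER REALISES `minAct`**: `A_k(V) = A^{(k)}(U)` for every `s`-constrained minimiser `U` at `V` (its action is the least element of
the common value set). [folklore] -/
theorem minAct_eq_levelAction_of_isMinimiserS (hL : 1 ≤ L)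
    (hC : ∀ (u : Site d → (Matrix n n ℂ)ˣ) (U : Site d → Fin d → (Matrix n n ℂ)ˣ), IsUnitarySite u →
      IsPeriodicSite u ((N * L ^ k : ℕ) : ℤ) → U ∈ 𝒞 k → gaugeAct u U ∈ 𝒞 k)
    (hE : SchemeGaugeEquiv d (fun _ => step42 L) s L N k (𝒞 k)) {V U : Site d → Fin d → (Matrix n n ℂ)ˣ}
    (hU : IsMinimiserS d s 𝒞 L N k V U) : minAct d 𝒞 L N k V = levelAction d L N k U := by
  rw [← sInf_levelAction_admissibleS_eq_minAct hL hC hE V]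
  refine IsLeast.csInf_eq ⟨Set.mem_image_of_mem _ hU.mem, ?_⟩
  rintro _ ⟨U', hU', rfl⟩
  exact hU.le U' hU'

/-- Admissibility of a datum for the `s`-constraint is admissibility for (43). [folklore] -/
theorem nonempty_admissibleS_iff_admissible (hL : 1 ≤ L)
    (hC : ∀ (u : Site d → (Matrix n n ℂ)ˣ) (U : Site d → Fin d → (Matrix n n ℂ)ˣ), IsUnitarySite u →
      IsPeriodicSite u ((N * L ^ k : ℕ) : ℤ) → U ∈ 𝒞 k → gaugeAct u U ∈ 𝒞 k)
    (hE : SchemeGaugeEquiv d (fun _ => step42 L) s L N k (𝒞 k)) (V : Site d → Fin d → (Matrix n n ℂ)ˣ) :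
    (admissibleS s 𝒞 k V).Nonempty ↔ (admissible 𝒞 L k V).Nonempty := by
  rw [nonempty_admissibleS_iff hL hC hE V, admissibleS_step42]

end Schemes

/-! ## §3 The instance: the centre-convention torus (42) `cstep` at every depth in the (8)-radius regime -/

section Instance

variable {P : Params} {N : ℕ} [NeZero N]

/-- **★★ THE `cstep`-CONSTRAINED MINIMAL ACTION IS `minAct` AT EVERY DEPTH AND DATUM**: on `sfClass d L T ε` with `0 ≤ ε`, `16C₀(d)ε ≤ 3`,
`1024(d+1)(d+4)L²ε ≤ 1`, for every `k` and `V`, the infimum of the level-`k` action over the configurations of the class whose `k`-fold centre-convention torus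
average is `V` equals `minAct d (sfClass d L T ε) L T k V` (part 16 `schemeGaugeEquiv_step42_cstep` in §2). [folklore] -/
theorem sInf_levelAction_admissibleS_cstep_eq_minAct (T k : ℕ) {ε : ℝ} (hε0 : 0 ≤ ε) (hε1 : 16 * C0 P.d * ε ≤ 3)
    (hε2 : 1024 * (P.d + 1) * (P.d + 4) * (P.L : ℝ) ^ 2 * ε ≤ 1) (V : Site P.d → Fin P.d → (Mat N)ˣ) :
    sInf (levelAction P.d P.L T k '' admissibleS (fun _ => cstep P N) (sfClass P.d P.L T ε) k V) = minAct P.d (sfClass P.d P.L T ε) P.L T k V := by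
  haveI : Nonempty (Fin N) := ⟨0⟩
  exact sInf_levelAction_admissibleS_eq_minAct (𝒞 := sfClass P.d P.L T ε) P.hL.2.le (fun u U hu huP hU => mem_sfClass_gaugeAct hu huP hU)
    (schemeGaugeEquiv_step42_cstep (P := P) (N := N) T k hε0 hε1 hε2) V

/-- The image form at every depth: `A^{(k)}(admissibleS cstep (sfClass …) k V) = A^{(k)}(admissible (sfClass …) L k V)`. [folklore] -/
theorem image_levelAction_admissibleS_cstep_eq (T k : ℕ) {ε : ℝ} (hε0 : 0 ≤ ε) (hε1 : 16 * C0 P.d * ε ≤ 3)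
    (hε2 : 1024 * (P.d + 1) * (P.d + 4) * (P.L : ℝ) ^ 2 * ε ≤ 1) (V : Site P.d → Fin P.d → (Mat N)ˣ) :
    levelAction P.d P.L T k '' admissibleS (fun _ => cstep P N) (sfClass P.d P.L T ε) k V =
      levelAction P.d P.L T k '' admissible (sfClass P.d P.L T ε) P.L k V := by
  haveI : Nonempty (Fin N) := ⟨0⟩
  exact image_levelAction_admissibleS_eq_admissible (𝒞 := sfClass P.d P.L T ε) P.hL.2.le (fun u U hu huP hU => mem_sfClass_gaugeAct hu huP hU)
    (schemeGaugeEquiv_step42_cstep (P := P) (N := N) T k hε0 hε1 hε2) V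

/-- A `cstep`-constrained minimiser realises `minAct` (every depth, regime). [folklore] -/
theorem minAct_eq_levelAction_of_isMinimiserS_cstep (T k : ℕ) {ε : ℝ} (hε0 : 0 ≤ ε) (hε1 : 16 * C0 P.d * ε ≤ 3)
    (hε2 : 1024 * (P.d + 1) * (P.d + 4) * (P.L : ℝ) ^ 2 * ε ≤ 1) {V U : Site P.d → Fin P.d → (Mat N)ˣ}
    (hU : IsMinimiserS P.d (fun _ => cstep P N) (sfClass P.d P.L T ε) P.L T k V U) :
    minAct P.d (sfClass P.d P.L T ε) P.L T k V = levelAction P.d P.L T k U := by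
  haveI : Nonempty (Fin N) := ⟨0⟩
  exact minAct_eq_levelAction_of_isMinimiserS (𝒞 := sfClass P.d P.L T ε) P.hL.2.le (fun u U hu huP hU => mem_sfClass_gaugeAct hu huP hU)
    (schemeGaugeEquiv_step42_cstep (P := P) (N := N) T k hε0 hε1 hε2) hU

/-- A datum is `cstep`-admissible iff it is (43)-admissible (every depth, regime). [folklore] -/
theorem nonempty_admissibleS_cstep_iff (T k : ℕ) {ε : ℝ} (hε0 : 0 ≤ ε) (hε1 : 16 * C0 P.d * ε ≤ 3)
    (hε2 : 1024 * (P.d + 1) * (P.d + 4) * (P.L : ℝ) ^ 2 * ε ≤ 1) (V : Site P.d → Fin P.d → (Mat N)ˣ) :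
    (admissibleS (fun _ => cstep P N) (sfClass P.d P.L T ε) k V).Nonempty ↔ (admissible (sfClass P.d P.L T ε) P.L k V).Nonempty := by
  haveI : Nonempty (Fin N) := ⟨0⟩
  exact nonempty_admissibleS_iff_admissible (𝒞 := sfClass P.d P.L T ε) P.hL.2.le (fun u U hu huP hU => mem_sfClass_gaugeAct hu huP hU)
    (schemeGaugeEquiv_step42_cstep (P := P) (N := N) T k hε0 hε1 hε2) V

end Instance

/-! ## §4 At N16's objects of record: the `act` of the reading carrier `minActReadings` is the `cstep`-constrained minimal action -/

section Record

variable (N : ℕ) [NeZero N] (F : T4Family) (K : ℕ)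

/-- **★ N16's END READING DOES NOT SEE THE CONVENTION**: for every family `F`, every `0 ≤ ε ≤ ε_reg(L) = min(3∕(16C₀(4)), 1∕(40960L²))`, every set of data `dom` and
every supplied local reading `loc`, the action entry of N16's reading carrier `minActReadings (sfClass 4 F.L (2L^m) ε) F.L (2L^m) dom loc` at `(k, V)` IS the minimal
level-`k` action over the configurations whose `k`-fold centre-convention torus average (`cstep (F.P K) N`) is `V` — so every `ActionRate` ∕ `NE3Shape` sentence about
this carrier is at once the sentence for the tree's NE7 torus instance of (42) in Setup's centred convention. [folklore] -/
theorem act_minActReadings_eq_sInf_cstep {ε : ℝ} (hε0 : 0 ≤ ε) (hεle : ε ≤ min (3 / (16 * C0 4)) (1 / (40960 * (F.L : ℝ) ^ 2)))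
    (dom : Set ((Fin 4 → ℤ) → Fin 4 → (MatA N)ˣ)) {X : Type*} (loc : ℕ → ((Fin 4 → ℤ) → Fin 4 → (MatA N)ˣ) → X → ℝ) (k : ℕ)
    (V : (Fin 4 → ℤ) → Fin 4 → (MatA N)ˣ) :
    (minActReadings 4 (sfClass 4 F.L (ne3NperOfRecord₁₁ F 0 0) ε) F.L (ne3NperOfRecord₁₁ F 0 0) dom loc).act k V =
      sInf (levelAction 4 F.L (ne3NperOfRecord₁₁ F 0 0) k ''
        admissibleS (fun _ => cstep (F.P K) N) (sfClass 4 F.L (ne3NperOfRecord₁₁ F 0 0) ε) k V) := by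
  obtain ⟨h1, h2⟩ := regime_of_le_regimeRadius F K hεle
  exact (sInf_levelAction_admissibleS_cstep_eq_minAct (P := F.P K) (N := N) (ne3NperOfRecord₁₁ F 0 0) k hε0 h1 h2 V).symm

/-- **★★ HENCE N16's READING CARRIER *IS* THE `cstep` READING CARRIER**: for every `0 ≤ ε ≤ ε_reg(L)`, `dom`, `loc`, the record carrier
`minActReadings (sfClass 4 F.L (2L^m) ε) F.L (2L^m) dom loc` EQUALS (as a `T4EtaRateMin.Readings` value) the carrier whose action entry is the minimal level-`k` action
over the configurations constrained by the centre-convention torus average `cstep (F.P K) N` — so EVERY predicate of readings (`ActionRate`, `LocalRate`, `NE3Shape`,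
`T4EtaRateMin.NE3Shape`-keyed record faces) takes the same value on both.  No new definition: the `cstep` carrier is displayed. [folklore] -/
theorem minActReadings_eq_cstepReadings {ε : ℝ} (hε0 : 0 ≤ ε) (hεle : ε ≤ min (3 / (16 * C0 4)) (1 / (40960 * (F.L : ℝ) ^ 2)))
    (dom : Set ((Fin 4 → ℤ) → Fin 4 → (MatA N)ˣ)) {X : Type*} (loc : ℕ → ((Fin 4 → ℤ) → Fin 4 → (MatA N)ˣ) → X → ℝ) :
    minActReadings 4 (sfClass 4 F.L (ne3NperOfRecord₁₁ F 0 0) ε) F.L (ne3NperOfRecord₁₁ F 0 0) dom loc =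
      { dom := dom
        act := fun k V => sInf (levelAction 4 F.L (ne3NperOfRecord₁₁ F 0 0) k ''
          admissibleS (fun _ => cstep (F.P K) N) (sfClass 4 F.L (ne3NperOfRecord₁₁ F 0 0) ε) k V)
        loc := loc
        vol := ((ne3NperOfRecord₁₁ F 0 0 : ℕ) : ℝ) ^ 4
        vol_nonneg := by positivity } := by
  have hact : (fun k V => minAct 4 (sfClass 4 F.L (ne3NperOfRecord₁₁ F 0 0) ε) F.L (ne3NperOfRecord₁₁ F 0 0) k V) =
      fun k V => sInf (levelAction 4 F.L (ne3NperOfRecord₁₁ F 0 0) k ''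
        admissibleS (fun _ => cstep (F.P K) N) (sfClass 4 F.L (ne3NperOfRecord₁₁ F 0 0) ε) k V) := by
    funext k V
    exact act_minActReadings_eq_sInf_cstep N F K hε0 hεle dom loc k V
  unfold minActReadings
  simp only [hact]

/-- **★ IN PARTICULAR N16's SHAPE `NE3Shape` (and `ActionRate`) READS THE SAME on the `cstep` carrier**: for every `C θ`, `NE3Shape` of the displayed `cstep` readings
carrier ⟺ `NE3Shape (minActReadings (sfClass 4 F.L (2L^m) ε) F.L (2L^m) dom loc)` — N16's `NE3Shape`-level sentences about the (43)-constrained minimal actions ARE the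
sentences about the centre-convention torus (42). [folklore] -/
theorem ne3Shape_cstepReadings_iff {ε : ℝ} (hε0 : 0 ≤ ε) (hεle : ε ≤ min (3 / (16 * C0 4)) (1 / (40960 * (F.L : ℝ) ^ 2)))
    (dom : Set ((Fin 4 → ℤ) → Fin 4 → (MatA N)ˣ)) {X : Type*} (loc : ℕ → ((Fin 4 → ℤ) → Fin 4 → (MatA N)ˣ) → X → ℝ) (C θ : ℝ) :
    T4EtaRateMin.NE3Shape
        ({ dom := dom
           act := fun k V => sInf (levelAction 4 F.L (ne3NperOfRecord₁₁ F 0 0) k ''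
             admissibleS (fun _ => cstep (F.P K) N) (sfClass 4 F.L (ne3NperOfRecord₁₁ F 0 0) ε) k V)
           loc := loc
           vol := ((ne3NperOfRecord₁₁ F 0 0 : ℕ) : ℝ) ^ 4
           vol_nonneg := by positivity } : T4EtaRateMin.Readings ((Fin 4 → ℤ) → Fin 4 → (MatA N)ˣ) X) C θ ↔
      T4EtaRateMin.NE3Shape (minActReadings 4 (sfClass 4 F.L (ne3NperOfRecord₁₁ F 0 0) ε) F.L (ne3NperOfRecord₁₁ F 0 0) dom loc) C θ := by
  rw [minActReadings_eq_cstepReadings N F K hε0 hεle dom loc]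

/-- The `ActionRate` face alone (N16's ACTION half, `MinimalActionRate.actionRate_of_sandwichData`'s conclusion shape) reads the same on the `cstep` carrier. [folklore] -/
theorem actionRate_cstepReadings_iff {ε : ℝ} (hε0 : 0 ≤ ε) (hεle : ε ≤ min (3 / (16 * C0 4)) (1 / (40960 * (F.L : ℝ) ^ 2)))
    (dom : Set ((Fin 4 → ℤ) → Fin 4 → (MatA N)ˣ)) {X : Type*} (loc : ℕ → ((Fin 4 → ℤ) → Fin 4 → (MatA N)ˣ) → X → ℝ) (C θ : ℝ) :
    T4EtaRateMin.ActionRate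
        ({ dom := dom
           act := fun k V => sInf (levelAction 4 F.L (ne3NperOfRecord₁₁ F 0 0) k ''
             admissibleS (fun _ => cstep (F.P K) N) (sfClass 4 F.L (ne3NperOfRecord₁₁ F 0 0) ε) k V)
           loc := loc
           vol := ((ne3NperOfRecord₁₁ F 0 0 : ℕ) : ℝ) ^ 4
           vol_nonneg := by positivity } : T4EtaRateMin.Readings ((Fin 4 → ℤ) → Fin 4 → (MatA N)ˣ) X) C θ ↔
      T4EtaRateMin.ActionRate (minActReadings 4 (sfClass 4 F.L (ne3NperOfRecord₁₁ F 0 0) ε) F.L (ne3NperOfRecord₁₁ F 0 0) dom loc) C θ := by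
  rw [minActReadings_eq_cstepReadings N F K hε0 hεle dom loc]

end Record

end

end Summit.QuantumFields.YangMills.BalabanUVNodes.N16SchemeMinActInvariance
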